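import Literature.AlgebraicGeometry.Morphisms.RigidityAllFibres
import Literature.AlgebraicGeometry.AbelianSchemes.AbelianSchemeOverHomNoetherian
import Literature.AlgebraicGeometry.AbelianSchemes.AbelianSchemeOverHomToGroupScheme
import Literature.AlgebraicGeometry.AbelianSchemes.LevelBasisFiniteEtaleCoverSurjective
import HarnessLib

/-!
# [MumfordFogartyKirwan1994, Ch. 6 §1 Cor. 6.4 / Cor. 6.5] over ANY locally Noetherian base — no reducedness, no connectedness:
# a unit-preserving `S`-morphism from an abelian scheme to a group scheme is a homomorphism; abelian schemes are commutative

Layer `Literature/AlgebraicGeometry/AbelianSchemes`, namespace `Literature.AlgebraicGeometry.AbelianSchemes.AbelianSchemeOver`.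
Cell `hodgecm-mathlib` (D-0151), F-DAG leaf F-1 (b′) (author B-p02 (g12)); count-neutral capital, PROOF lane, theorems only
(no definition, no named fact, no instance, no `sorry`).  HC_CM is proved only modulo the 7 printed citations until rung 0
closes; this file asserts nothing about HC.

★ `AbelianSchemeOverHomNoetherian` (B-p03 (g16)) proves Cor. 6.4 (`isMonHom_of_one_comp_of_isLocallyNoetherian`) and Cor. 6.5
(`isCommMonObj_of_isLocallyNoetherian`) over a locally Noetherian PRECONNECTED base, through the engine
`hom_eq_of_forall_fromSpecResidueField_comp_eq` ending in the one-fibre rigidity lemma ★ `Morphisms.rigidity_of_stein`, whose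
connectedness hypothesis spreads the contraction of one fibre to all.  In the engine the quotient `f · g⁻¹` of the two
morphisms is POINTWISE the unit section — EVERY fibre is contracted — so the all-fibres rigidity lemma ★
`Morphisms.eq_comp_of_forall_fibre_const_of_stein` (no connectedness, no separatedness, no openness) ends the proof over
any base.  This file re-runs B-p03's proofs with that ending (the bodies of §1–§2 are adapted verbatim from ★
`AbelianSchemeOverHomNoetherian`, credited here):

* §1 `hom_eq_of_forall_fromSpecResidueField_comp_eq_of_stein` — `P/S` universally closed and Stein with an `S`-point
  `e`, `G/S` any group scheme; two `S`-morphisms `f, g : P → G` agreeing at every residue-field point of `P` and after `e`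
  are EQUAL (no connectedness, no separatedness, no openness);
* §2 **`isMonHom_of_one_comp_of_isLocallyNoetherian_base`** — Cor. 6.4 for abelian-scheme targets over ANY locally
  Noetherian base; **`isMonHom_of_one_comp_of_grpObj_of_isLocallyNoetherian`** — Cor. 6.4 AS PRINTED («`G` any group scheme
  over `S`»: separated and locally of finite type; field case ★ `FibrePoints.mul_comp_eq_of_one_comp_of_grpObj`, B-p18 (g13));
  **`isCommMonObj_of_isLocallyNoetherian_base`** — Cor. 6.5: an abelian scheme over ANY locally Noetherian base is a
  commutative group scheme (a theorem, not an instance);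
* §3 the `[IsCommMonObj A.X]` hypothesis of ★ `LevelBasisFiniteEtaleCover(Surjective)` discharged over a locally Noetherian
  base: **`exists_finite_etale_surjective_levelStructure_of_isLocallyNoetherian`** — every abelian scheme of relative
  dimension `g` over a locally Noetherian `S`, `M ≠ 0` invertible on `S`, admits a level-`M` structure over a finite étale
  SURJECTIVE `B → S` realising every `ℤ/M`-basis of a fibre ([MumfordFogartyKirwan1994] Prop. 7.3 step (IV),
  [GortzWedhorn2023] Prop. 27.188 (1)); `exists_mulHom_torsion_fibrePoints_of_isLocallyNoetherian` — `A_s̄(Ω)[M] ≅ (ℤ/M)^{2g}`.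

## References
* [MumfordFogartyKirwan1994] D. Mumford, J. Fogarty, F. Kirwan, *Geometric Invariant Theory*, 3rd ed. (1994), Ch. 6 §1
  Prop. 6.1 (pp. 115–116), Cor. 6.4 / Cor. 6.5 (p. 117); Ch. 7 §2 Proposition 7.3, proof, step (IV) (pp. 133–134); Ch. 7
  §3 Lemma 7.11 (p. 140).
* [MumfordAV1970] D. Mumford, *Abelian Varieties* (1970), §4 Rigidity lemma (p. 43).
* [Milne1986AbelianVarieties] J. S. Milne, *Abelian Varieties*, in Cornell–Silverman (1986), §2 Cor. 2.2 (p. 105).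
* [GortzWedhorn2023] U. Görtz, T. Wedhorn, *Algebraic Geometry II* (2023), Cor. 24.63 (p. 404); Prop. 27.188 (1) (p. 675).
-/

noncomputable section

universe u

open CategoryTheory CategoryTheory.Limits AlgebraicGeometry MonoidalCategory CartesianMonoidalCategory
open scoped MonObj CategoryTheory.Obj

namespace Literature.AlgebraicGeometry.AbelianSchemes

namespace AbelianSchemeOver

open Literature.AlgebraicGeometry.Morphisms Literature.AlgebraicGeometry.Motives

variable {S : Scheme.{u}}

/-! ### §1 The engine over any base: Stein + a section + pointwise agreement ⇒ equality of morphisms to a group scheme -/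

/-- **Pointwise-equal morphisms from a Stein `S`-scheme with a section to a group scheme are equal — ANY base**
([MumfordFogartyKirwan1994] Cor. 6.2/6.4, proof pattern; no reducedness, no connectedness): `P/S` universally closed and
Stein (`Γ(W, 𝒪_S) ⥲ Γ(p⁻¹W, 𝒪_P)` for all `W`) with an `S`-point `e : 𝟙 → P`; `G/S` an `S`-group scheme; `f, g : P → G` two
`S`-morphisms with `z ≫ f = z ≫ g` for every residue-field point `z : Spec κ(z) → P` and `e ≫ f = e ≫ g`.  Then `f = g`:
`f · g⁻¹` is pointwise the unit section, i.e. it contracts EVERY fibre of `P → S` (to the unit point of the fibre of `G`),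
hence (★ `Morphisms.eq_comp_of_forall_fibre_const_of_stein`) equals `toUnit ≫ e ≫ (f · g⁻¹) = toUnit ≫ 1 = 1`.  Body adapted
from ★ `hom_eq_of_forall_fromSpecResidueField_comp_eq` (B-p03 (g16)). [cite: MumfordFogartyKirwan1994, Ch. 6 §1 Corollary 6.4 (p. 117), proof]
[cite: MumfordAV1970, §4 Rigidity lemma (p. 43)] -/
theorem hom_eq_of_forall_fromSpecResidueField_comp_eq_of_stein {P : Over S} [UniversallyClosed P.hom]
    (hStein : ∀ W : S.Opens, Function.Bijective (P.hom.app W).hom) (e : 𝟙_ (Over S) ⟶ P)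
    {G : Over S} [GrpObj G] (f g : P ⟶ G)
    (hfg : ∀ z : P.left, P.left.fromSpecResidueField z ≫ f.left = P.left.fromSpecResidueField z ≫ g.left)
    (he : e ≫ f = e ≫ g) : f = g := by
  -- the quotient `F := f · g⁻¹` is pointwise the unit section
  have hpt : ∀ z : P.left, (f * g⁻¹).left.base z = (η[G]).left.base (P.hom.base z) := by
    intro z
    let Pz : Over.mk (P.left.fromSpecResidueField z ≫ P.hom) ⟶ P := Over.homMk (P.left.fromSpecResidueField z) rfl
    have hPz : Pz ≫ f = Pz ≫ g := by
      ext : 1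
      exact hfg z
    have hq : Pz ≫ (f * g⁻¹) = toUnit _ ≫ η[G] := by
      rw [MonObj.comp_mul, GrpObj.comp_inv, hPz, mul_inv_cancel, Hom.one_def]
    have := congrArg (fun φ => φ.left.base (IsLocalRing.closedPoint (P.left.residueField z))) hq
    simp only [Over.comp_left, Scheme.Hom.comp_base, TopCat.comp_app, Over.toUnit_left] at this
    change (f * g⁻¹).left.base ((P.left.fromSpecResidueField z).base (IsLocalRing.closedPoint _)) =
      (η[G]).left.base ((P.left.fromSpecResidueField z ≫ P.hom).base (IsLocalRing.closedPoint _)) at this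
    rw [Scheme.Hom.comp_apply, Scheme.fromSpecResidueField_apply] at this
    exact this
  -- `e` is a section of `P → S`
  have he₁ : e.left ≫ P.hom = 𝟙 S := by
    rw [Over.w e]
    rfl
  -- all-fibres rigidity: `F` factors through the base (no connectedness needed: EVERY fibre is contracted)
  have hrig : (f * g⁻¹).left = P.hom ≫ e.left ≫ (f * g⁻¹).left :=
    eq_comp_of_forall_fibre_const_of_stein (p := P.hom) (f * g⁻¹).left e.left he₁ hStein fun s =>
      ⟨(η[G]).left.base s, fun z hz => by rw [hpt z, hz]⟩
  have hF : f * g⁻¹ = toUnit P ≫ e ≫ (f * g⁻¹) := by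
    ext : 1
    rw [Over.comp_left, Over.comp_left, Over.toUnit_left]
    exact hrig
  have heF : e ≫ (f * g⁻¹) = 1 := by
    rw [MonObj.comp_mul, GrpObj.comp_inv, he, mul_inv_cancel]
  rw [heF, MonObj.comp_one] at hF
  exact mul_inv_eq_one.mp hF

/-! ### §2 Cor. 6.4 and Cor. 6.5 over any locally Noetherian base -/

variable {A B : AbelianSchemeOver S}

/-- **[MumfordFogartyKirwan1994] Cor. 6.4 over ANY locally Noetherian base — no reducedness, no connectedness**: an
`S`-morphism `f : X → Y` of abelian schemes with `f ∘ ε_X = ε_Y` is a homomorphism of `S`-group schemes.  Proof: `μ_X ≫ f`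
and `(f × f) ≫ μ_Y : X ×_S X → Y` agree at every residue-field point of `X ×_S X` (★ `comp_mul_left_eq`,
`comp_tensorHom_mul_left_eq`, `FibrePoints.mul_comp_eq_of_one_comp` — the field case, [Milne1986AbelianVarieties] Cor. 2.2)
and after the `S`-point `(ε, ε)`; `X ×_S X → S` is Stein (★ `tensor_app_bijective_of_isLocallyNoetherian`); the engine of §1
concludes.  Body adapted from ★ `isMonHom_of_one_comp_of_isLocallyNoetherian` (B-p03 (g16)).
[cite: MumfordFogartyKirwan1994, Ch. 6 §1 Corollary 6.4 (p. 117)] [cite: Milne1986AbelianVarieties, §2 Cor. 2.2 (p. 105)] -/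
theorem isMonHom_of_one_comp_of_isLocallyNoetherian_base [IsLocallyNoetherian S] (f : A.X ⟶ B.X)
    (hf : η[A.X] ≫ f = η[B.X]) : IsMonHom f where
  one_hom := hf
  mul_hom := by
    haveI := A.universallyClosed_hom
    haveI : UniversallyClosed (A.X ⊗ A.X).hom :=
      MorphismProperty.comp_mem _ _ _ (MorphismProperty.pullback_fst _ _ A.universallyClosed_hom)
        A.universallyClosed_hom
    refine hom_eq_of_forall_fromSpecResidueField_comp_eq_of_stein A.tensor_app_bijective_of_isLocallyNoetherian
      (lift η[A.X] η[A.X]) (μ[A.X] ≫ f) ((f ⊗ₘ f) ≫ μ[B.X]) (fun z => ?_) ?_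
    · have h1 := A.comp_mul_left_eq (Ω := ↥((A.X ⊗ A.X).left.residueField z))
        ((A.X ⊗ A.X).left.fromSpecResidueField z)
      have h2 := comp_tensorHom_mul_left_eq f (Ω := ↥((A.X ⊗ A.X).left.residueField z))
        ((A.X ⊗ A.X).left.fromSpecResidueField z)
      simp only [Over.comp_left] at h1 h2 ⊢
      rw [h2, ← FibrePoints.mul_comp_eq_of_one_comp f hf, Over.comp_left, ← h1]
      exact (Category.assoc _ _ _).symm
    · rw [← Category.assoc, A.lift_unit_comp_mul, hf, ← Category.assoc, lift_map, hf, ← Hom.mul_def]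
      have h1 : (η[B.X] : 𝟙_ (Over S) ⟶ B.X) = 1 := by
        rw [Hom.one_def, toUnit_unique (toUnit _) (𝟙 _), Category.id_comp]
      rw [h1, mul_one]

/-- **[MumfordFogartyKirwan1994] Cor. 6.4 AS PRINTED («`G` ANY group scheme over `S`»), over any locally Noetherian base — no
reducedness, no connectedness**: for an abelian scheme `X/S`, a separated `S`-group scheme `G` locally of finite type and an
`S`-morphism `f : X → G` with `f ∘ ε_X = e_G`, `f` is a homomorphism.  Field case on the fibres: ★
`FibrePoints.mul_comp_eq_of_one_comp_of_grpObj` / ★ `comp_tensorHom_mul_left_eq_of_grpObj` (B-p18 (g13)); Stein + §1.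
[cite: MumfordFogartyKirwan1994, Ch. 6 §1 Corollary 6.4 (p. 117)] [cite: Milne1986AbelianVarieties, §2 Cor. 2.2 (p. 105)] -/
theorem isMonHom_of_one_comp_of_grpObj_of_isLocallyNoetherian [IsLocallyNoetherian S] {G : Over S} [GrpObj G]
    [IsSeparated G.hom] [LocallyOfFiniteType G.hom] (f : A.X ⟶ G) (hf : η[A.X] ≫ f = η[G]) : IsMonHom f where
  one_hom := hf
  mul_hom := by
    haveI := A.universallyClosed_hom
    haveI : UniversallyClosed (A.X ⊗ A.X).hom :=
      MorphismProperty.comp_mem _ _ _ (MorphismProperty.pullback_fst _ _ A.universallyClosed_hom)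
        A.universallyClosed_hom
    refine hom_eq_of_forall_fromSpecResidueField_comp_eq_of_stein A.tensor_app_bijective_of_isLocallyNoetherian
      (lift η[A.X] η[A.X]) (μ[A.X] ≫ f) ((f ⊗ₘ f) ≫ μ[G]) (fun z => ?_) ?_
    · have h1 := A.comp_mul_left_eq (Ω := ↥((A.X ⊗ A.X).left.residueField z))
        ((A.X ⊗ A.X).left.fromSpecResidueField z)
      have h2 := comp_tensorHom_mul_left_eq_of_grpObj f (Ω := ↥((A.X ⊗ A.X).left.residueField z))
        ((A.X ⊗ A.X).left.fromSpecResidueField z)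
      simp only [Over.comp_left] at h1 h2 ⊢
      rw [h2, ← FibrePoints.mul_comp_eq_of_one_comp_of_grpObj f hf, Over.comp_left, ← h1]
      exact (Category.assoc _ _ _).symm
    · rw [← Category.assoc, A.lift_unit_comp_mul, hf, ← Category.assoc, lift_map, hf, ← Hom.mul_def]
      have h1 : (η[G] : 𝟙_ (Over S) ⟶ G) = 1 := by
        rw [Hom.one_def, toUnit_unique (toUnit _) (𝟙 _), Category.id_comp]
      rw [h1, mul_one]

variable (A)

/-- **[MumfordFogartyKirwan1994] Cor. 6.5 over ANY locally Noetherian base — no reducedness, no connectedness**: an abelian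
scheme is a COMMUTATIVE `S`-group scheme.  Proof: `μ` and `swap ≫ μ : X ×_S X → X` agree at every residue-field point (★
`comp_mul_left_eq`, `comp_braiding_mul_left_eq`, `FibrePoints.mul_comm` — the field case) and after `(ε, ε)`; Stein + the
engine of §1.  A theorem, not an instance.  Body adapted from ★ `isCommMonObj_of_isLocallyNoetherian` (B-p03 (g16)).
[cite: MumfordFogartyKirwan1994, Ch. 6 §1 Corollary 6.5 (p. 117)] [cite: MumfordAV1970, §4 Rigidity lemma (p. 43)] -/
theorem isCommMonObj_of_isLocallyNoetherian_base [IsLocallyNoetherian S] : IsCommMonObj A.X where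
  mul_comm := by
    haveI := A.universallyClosed_hom
    haveI : UniversallyClosed (A.X ⊗ A.X).hom :=
      MorphismProperty.comp_mem _ _ _ (MorphismProperty.pullback_fst _ _ A.universallyClosed_hom)
        A.universallyClosed_hom
    refine hom_eq_of_forall_fromSpecResidueField_comp_eq_of_stein A.tensor_app_bijective_of_isLocallyNoetherian
      (lift η[A.X] η[A.X]) ((β_ A.X A.X).hom ≫ μ[A.X]) μ[A.X] (fun z => ?_) ?_
    · have h1 := A.comp_braiding_mul_left_eq (Ω := ↥((A.X ⊗ A.X).left.residueField z))
        ((A.X ⊗ A.X).left.fromSpecResidueField z)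
      have h2 := A.comp_mul_left_eq (Ω := ↥((A.X ⊗ A.X).left.residueField z))
        ((A.X ⊗ A.X).left.fromSpecResidueField z)
      rw [FibrePoints.mul_comm] at h1
      exact h1.trans h2.symm
    · rw [← Category.assoc, lift_braiding_hom, A.lift_unit_comp_mul]

/-! ### §3 Level-`M` structures exist over a finite étale surjective cover — any locally Noetherian base -/

/-- **`A_s̄(Ω)[M] ≅ (ℤ/M)^{2g}` over a locally Noetherian base** (★ `exists_mulHom_torsion_fibrePoints` with the commutativity
hypothesis discharged by `isCommMonObj_of_isLocallyNoetherian_base`). [cite: GortzWedhorn2023, Prop. 27.188 (1) (p. 675)]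
[cite: MumfordFogartyKirwan1994, Ch. 6 §1 Corollary 6.5 (p. 117)] -/
theorem exists_mulHom_torsion_fibrePoints_of_isLocallyNoetherian [IsLocallyNoetherian S] {Ω : Type u} [Field Ω]
    [IsAlgClosed Ω] (s : Spec (.of Ω) ⟶ S) {g M : ℕ} (hg : A.IsOfRelDim g) (hM : 0 < M) (hMΩ : (M : Ω) ≠ 0) :
    letI := A.isCommMonObj_of_isLocallyNoetherian_base
    ∃ φ : Multiplicative (Fin g ⊕ Fin g → ZMod M) →* A.FibrePoints s,
      Function.Injective φ ∧ Set.range φ = {y | y ^ M = 1} := by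
  letI := A.isCommMonObj_of_isLocallyNoetherian_base
  exact A.exists_mulHom_torsion_fibrePoints s hg hM hMΩ

/-- **A LEVEL-`M` STRUCTURE EXISTS OVER A FINITE ÉTALE SURJECTIVE COVER — any locally Noetherian base** ([MumfordFogartyKirwan1994]
Prop. 7.3, proof, step (IV) / Lemma 7.11; [GortzWedhorn2023] Prop. 27.188 (1)): for an abelian scheme `A/S` of relative
dimension `g` over a locally Noetherian `S` and `M ≠ 0` invertible in the residue fields of `S`, there are a finite étale
SURJECTIVE `b : B → S` and a level-`M` structure on `A ×_S B` realising every ordered `ℤ/M`-basis of the `M`-torsion of a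
fibre — ★ `exists_finite_etale_surjective_levelStructure` with `[IsCommMonObj A.X]` discharged by
`isCommMonObj_of_isLocallyNoetherian_base`. [cite: MumfordFogartyKirwan1994, Ch. 7 §2 Proposition 7.3, proof, step (IV) (pp. 133–134)]
[cite: MumfordFogartyKirwan1994, Ch. 7 §3 Lemma 7.11 (p. 140)] [cite: GortzWedhorn2023, Prop. 27.188 (1) (p. 675)] -/
theorem exists_finite_etale_surjective_levelStructure_of_isLocallyNoetherian [IsLocallyNoetherian S] {g M : ℕ}
    [NeZero M] (hg : A.IsOfRelDim g) (hM : ∀ s : S, (M : S.residueField s) ≠ 0) :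
    letI := A.isCommMonObj_of_isLocallyNoetherian_base
    ∃ (B : Scheme.{u}) (b : B ⟶ S), IsFinite b ∧ Etale b ∧ Surjective b ∧
      Nonempty (LevelStructure g M (A.baseChange b)) ∧
      ∀ ⦃Ω : Type u⦄ [Field Ω] (s : Spec (.of Ω) ⟶ S) (x : Fin g ⊕ Fin g → A.FibrePoints s),
        (∀ i, x i ^ M = 1) →
        Function.Injective (fun a : Fin g ⊕ Fin g → ZMod M =>
          (List.ofFn fun i : Fin g => x (Sum.inl i) ^ (a (Sum.inl i)).val).prod *
            (List.ofFn fun i : Fin g => x (Sum.inr i) ^ (a (Sum.inr i)).val).prod) →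
        ∃ t : Spec (.of Ω) ⟶ B, t ≫ b = s := by
  letI := A.isCommMonObj_of_isLocallyNoetherian_base
  exact A.exists_finite_etale_surjective_levelStructure hg hM

/-- The short form: **every abelian scheme of relative dimension `g` over a locally Noetherian base admits a level-`M`
structure over some finite étale surjective `B → S`** (`M ≠ 0` invertible on `S`).
[cite: GortzWedhorn2023, Prop. 27.188 (1) (p. 675)] [cite: MumfordFogartyKirwan1994, Ch. 7 §3 Lemma 7.11 (p. 140)] -/
theorem exists_finite_etale_surjective_nonempty_levelStructure_of_isLocallyNoetherian [IsLocallyNoetherian S]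
    {g M : ℕ} [NeZero M] (hg : A.IsOfRelDim g) (hM : ∀ s : S, (M : S.residueField s) ≠ 0) :
    ∃ (B : Scheme.{u}) (b : B ⟶ S), IsFinite b ∧ Etale b ∧ Surjective b ∧
      Nonempty (LevelStructure g M (A.baseChange b)) := by
  letI := A.isCommMonObj_of_isLocallyNoetherian_base
  exact A.exists_finite_etale_surjective_nonempty_levelStructure hg hM

end AbelianSchemeOver

end Literature.AlgebraicGeometry.AbelianSchemes

end
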